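import Literature.Geometry.Symplectic.SymplecticTraceHessianIntegral
import Literature.Geometry.Symplectic.TaubesFamilyWeitzenbock
import Literature.Geometry.GaugeTheory.SeibergWittenAPrioriBoundGlobal
import HarnessLib

/-!
# Taubes 1994, §2: the integrated Bochner–Weitzenböck identity for the family `(SW_r)`

Topic `Literature/Geometry/Symplectic`; continues `SymplecticTraceHessianIntegral` (`∫ Δf ω² = 0`)
and `TaubesFamilyWeitzenbock` (the pointwise identity (9)/(12)).  Taubes 1994, proof of Lemma 3:
"take the inner product of both sides of [(12)] with `ψ` and use (6) to obtain the equation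
`½ d*d|ψ|² + |∇_Aψ|² + (s/4)|ψ|² + ¼|ψ|²(|ψ|² - ...) = 0` ... integrating both sides of this last
equation over `X`" — on the closed symplectic `4`-manifold the Laplacian term integrates to zero.

For a configuration `(A, ψ)` of `𝔰_J` on `(N, s, J)` (volume form `s ∧ s`, unitary frames `e` of the
chart at each point, `∇̃` the `Spin^c` covariant derivative, `∇_A^*∇_A = -Σ_k(∇̃_{e_k}∇̃_{e_k} - ∇̃_{∇_{e_k}e_k})`):

* `traceHessian_hermNormSq_eq`: `Σ_k Hess(|ψ|²)(e_k,e_k) = 2Σ_k|∇̃_{e_k}ψ|² - 2Re⟨∇_A^*∇_Aψ, ψ⟩`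
  (the Bochner–Kato identity of `SeibergWittenAPrioriBound`, for the global function `|ψ|²`);
* **`integral_re_laplacian_sub_gradNormSq_eq_zero`**: `∫_N (Re⟨∇_A^*∇_Aψ, ψ⟩ - Σ_k|∇̃_{e_k}ψ|²)(s ∧ s) = 0`
  — the formal self-adjointness `∫⟨∇_A^*∇_Aψ, ψ⟩ = ∫|∇_Aψ|²` on the closed manifold;
* **`integral_taubes_identity_eq_zero`**: for a solution `(A, ψ)` of `(SW)` with perturbation
  `η₀ - (r/4)s` (`r = |c|²`),
  `∫_N (Σ_k|∇̃_{e_k}ψ|² + (κ/4)|ψ|² + |ψ|⁴/4 - (r/4)(|ψ₁|² - |ψ₀|²) + Re⟨½iρ⁺(η₀)ψ, ψ⟩)(s ∧ s) = 0`,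
  Taubes's integrated identity (from which the `L²` bound on `∇_Aψ` of Lemma 3 is read off).

PROVED, 0 named facts.

## References

* C. H. Taubes, *The Seiberg–Witten invariants and symplectic forms*, Math. Res. Lett. 1 (1994)
  809–822, §2 (9), (12)–(13), proof of Lemma 3 (p. 814). [Taubes1994]
* J. W. Morgan, *The Seiberg–Witten Equations and Applications to the Topology of Smooth
  Four-Manifolds*, Princeton Math. Notes 44 (1996), Cor. 5.1.7, Cor. 5.2.2. [MorganSWBook1996]
-/

noncomputable section

open scoped Manifold ContDiff ComplexConjugate Matrix Topology
open Set Function Filter Complex Literature.Geometry.Kaehler Literature.Geometry.GaugeTheory Literature.Topology.FourManifolds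
open Literature.Geometry.Lorentzian (PseudoRiemannianMetric)
open Literature.Geometry.Manifold Literature.Geometry.Manifold.DeRhamSignFour Literature.NumberTheory.Transcendental

namespace Literature.Geometry.GaugeTheory

variable {X : Type*} [TopologicalSpace X] [ChartedSpace (EuclideanSpace ℝ (Fin 4)) X] [IsManifold (𝓡 4) ∞ X]

/-- The frame Hessian `Hess f(X, Y)(x) = X(Yf)(x) - (∇_XY f)(x)` only depends on `f` near `x`. [folklore] -/
theorem hessianAux_congr_of_eventuallyEq (g : PseudoRiemannianMetric (𝓡 4) ∞ (EuclideanSpace ℝ (Fin 4)) (TangentSpace (𝓡 4) : X → Type _))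
    [g.HasLeviCivita] {f f' : X → ℝ} {x : X} (h : f =ᶠ[𝓝 x] f') (V W : Π y : X, TangentSpace (𝓡 4) y) :
    g.hessianAux f V W x = g.hessianAux f' V W x := by
  have h1 : (fun y ↦ mvfderiv (𝓡 4) f y (W y)) =ᶠ[𝓝 x] fun y ↦ mvfderiv (𝓡 4) f' y (W y) := by
    filter_upwards [h.eventuallyEq_nhds] with y hy
    rw [Literature.Geometry.Lorentzian.mvfderiv_congr_nhds hy]
  unfold PseudoRiemannianMetric.hessianAux
  rw [Literature.Geometry.Lorentzian.mvfderiv_congr_nhds h1, Literature.Geometry.Lorentzian.mvfderiv_congr_nhds h]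

namespace SpincStructure

variable {g : PseudoRiemannianMetric (𝓡 4) ∞ (EuclideanSpace ℝ (Fin 4)) (TangentSpace (𝓡 4) : X → Type _)}
  {o : SmoothOrientation (𝓡 4) X} {ι : Type*} (𝔰 : SpincStructure g o ι)

/-- **`|ψ|²` is smooth** for a smooth spinor field (on each chart it is the polynomial `Re⟨ψ_i, ψ_i⟩` of
the smooth local spinor). [folklore] -/
theorem contMDiff_hermNormSq {ψ : SpinorField 𝔰} (hψ : ψ.IsSmooth) : ContMDiff (𝓡 4) 𝓘(ℝ, ℝ) ∞ ψ.hermNormSq := by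
  intro x
  have hi := 𝔰.mem_baseSet_indexAt x
  have hnhds := (𝔰.isOpen_baseSet (𝔰.indexAt x)).mem_nhds hi
  have hs : ∀ a, ContMDiffAt (𝓡 4) 𝓘(ℝ, ℂ) ∞ (fun y ↦ ψ.toFun (𝔰.indexAt x) y a) x := fun a ↦ (hψ _ a).contMDiffAt hnhds
  have hpi : ContMDiffAt (𝓡 4) 𝓘(ℝ, Spinor → ℂ) ∞ (ψ.toFun (𝔰.indexAt x)) x := contMDiffAt_pi_space.2 hs
  exact (contDiff_re_star_dotProduct_self.comp_contMDiffAt hpi).congr_of_eventuallyEq (ψ.hermNormSq_eventuallyEq hi)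

end SpincStructure

end Literature.Geometry.GaugeTheory

namespace Literature.Geometry.Symplectic

namespace AlmostComplexStructure.IsCompatibleWith

variable {N : Type} [TopologicalSpace N] [ChartedSpace (EuclideanSpace ℝ (Fin 4)) N] [IsManifold (𝓡 4) ∞ N]
  {J : AlmostComplexStructure (𝓡 4) ∞ N} {s : MForm (𝓡 4) N ℝ 2}
  (h : J.IsCompatibleWith s) (hs : IsSmoothForm s)
  (hnd : ∀ x (v : TangentSpace (𝓡 4) x), v ≠ 0 → ∃ w : TangentSpace (𝓡 4) x, s x ![v, w] ≠ 0)
  [(h.metric hs).HasLeviCivita]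

/-- **`|∇_Aψ|²(x) = Σ_k |∇̃_{e_k}ψ|²(x)`**, the pointwise square norm of the covariant derivative of the
spinor of a configuration, in the unitary frame of the chart of `𝔰_J` at `x`. [cite: Taubes1994, §2 Lemma 3] -/
def gradNormSq (cfg : (h.canonicalSpincStructure hs hnd).Configuration) (x : N) : ℝ :=
  ∑ k, (star ((h.canonicalSpincStructure hs hnd).localCovDeriv cfg.conn ((h.canonicalSpincStructure hs hnd).indexAt x)
      (cfg.spinor.toFun ((h.canonicalSpincStructure hs hnd).indexAt x)) x
      ((h.canonicalSpincStructure hs hnd).frame ((h.canonicalSpincStructure hs hnd).indexAt x) k x)) ⬝ᵥ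
    (h.canonicalSpincStructure hs hnd).localCovDeriv cfg.conn ((h.canonicalSpincStructure hs hnd).indexAt x)
      (cfg.spinor.toFun ((h.canonicalSpincStructure hs hnd).indexAt x)) x
      ((h.canonicalSpincStructure hs hnd).frame ((h.canonicalSpincStructure hs hnd).indexAt x) k x)).re

/-- **`Re⟨∇_A^*∇_Aψ, ψ⟩(x)`** in the chart of `𝔰_J` at `x` (`∇_A^*∇_A = localLaplacian`). [cite: Taubes1994, §2 (12)] -/
def reLaplacian (cfg : (h.canonicalSpincStructure hs hnd).Configuration) (x : N) : ℝ :=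
  (star (cfg.spinor.toFun ((h.canonicalSpincStructure hs hnd).indexAt x) x) ⬝ᵥ
    (h.canonicalSpincStructure hs hnd).localLaplacian cfg.conn ((h.canonicalSpincStructure hs hnd).indexAt x)
      (cfg.spinor.toFun ((h.canonicalSpincStructure hs hnd).indexAt x)) x).re

/-- **The Bochner–Kato identity for the global function `|ψ|²`** in the unitary frame at `x`:
`Σ_k Hess(|ψ|²)(e_k, e_k)(x) = 2Σ_k|∇̃_{e_k}ψ|²(x) - 2Re⟨∇_A^*∇_Aψ, ψ⟩(x)`. [cite: MorganSWBook1996, Cor. 5.2.2 (proof)] -/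
theorem traceHessian_hermNormSq_eq (cfg : (h.canonicalSpincStructure hs hnd).Configuration) (x : N) :
    h.traceHessian hs hnd cfg.spinor.hermNormSq x = 2 * h.gradNormSq hs hnd cfg x - 2 * h.reLaplacian hs hnd cfg x := by
  have hi := (h.canonicalSpincStructure hs hnd).mem_baseSet_indexAt x
  have hs2 : ∀ a, ContMDiffOn (𝓡 4) 𝓘(ℝ, ℂ) 2 (fun y ↦ cfg.spinor.toFun ((h.canonicalSpincStructure hs hnd).indexAt x) y a)
      ((h.canonicalSpincStructure hs hnd).baseSet ((h.canonicalSpincStructure hs hnd).indexAt x)) := fun a ↦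
    (cfg.isSmooth _ a).of_le (inferInstance : ENat.LEInfty (2 : ℕ∞ω)).out
  have hBK := (h.canonicalSpincStructure hs hnd).neg_sum_hessianAux_normSq cfg.conn hi hs2
  have hcongr : ∀ k, (h.metric hs).hessianAux cfg.spinor.hermNormSq
      ((h.canonicalSpincStructure hs hnd).frame ((h.canonicalSpincStructure hs hnd).indexAt x) k)
      ((h.canonicalSpincStructure hs hnd).frame ((h.canonicalSpincStructure hs hnd).indexAt x) k) x =
      (h.metric hs).hessianAux (spinorNormSqFun (cfg.spinor.toFun ((h.canonicalSpincStructure hs hnd).indexAt x)))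
      ((h.canonicalSpincStructure hs hnd).frame ((h.canonicalSpincStructure hs hnd).indexAt x) k)
      ((h.canonicalSpincStructure hs hnd).frame ((h.canonicalSpincStructure hs hnd).indexAt x) k) x := fun k ↦
    hessianAux_congr_of_eventuallyEq _ (cfg.spinor.hermNormSq_eventuallyEq hi) _ _
  rw [traceHessian_apply, Finset.sum_congr rfl fun k _ ↦ hcongr k, gradNormSq, reLaplacian]
  linarith [hBK]

/-- **`∫_N (Re⟨∇_A^*∇_Aψ, ψ⟩ - |∇_Aψ|²)(s ∧ s) = 0`** on the closed symplectic `4`-manifold — the formal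
self-adjointness `∫⟨∇_A^*∇_Aψ, ψ⟩ = ∫|∇_Aψ|²`: the integrand is `-½ Σ_k Hess(|ψ|²)(e_k,e_k)`, which
integrates to zero (`integral_traceHessian_smul_wedge_self_eq_zero`). [cite: MorganSWBook1996, Cor. 5.2.2]
[cite: Taubes1994, §2 (proof of Lemma 3, p. 814)] -/
theorem integral_reLaplacian_sub_gradNormSq_eq_zero [T2Space N] [CompactSpace N] (hcl : IsClosedForm s)
    (cfg : (h.canonicalSpincStructure hs hnd).Configuration) :
    MForm.integral (rayFamily (wedge_self_castDeg_apply_ne_zero s hnd))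
      ((fun x ↦ h.reLaplacian hs hnd cfg x - h.gradNormSq hs hnd cfg x) • (s.wedge s).castDeg two_add_two_eq_four) = 0 := by
  have hint := h.integral_traceHessian_smul_wedge_self_eq_zero hs hnd hcl
    ((h.canonicalSpincStructure hs hnd).contMDiff_hermNormSq cfg.isSmooth)
  have heq : (h.traceHessian hs hnd cfg.spinor.hermNormSq) • (s.wedge s).castDeg two_add_two_eq_four =
      (-2 : ℝ) • ((fun x ↦ h.reLaplacian hs hnd cfg x - h.gradNormSq hs hnd cfg x) • (s.wedge s).castDeg two_add_two_eq_four) := by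
    funext x
    ext w
    simp [h.traceHessian_hermNormSq_eq hs hnd cfg x]
    ring
  rw [heq, MForm.integral_smul] at hint
  simpa using hint

/-- **Taubes's integrated identity for the family** (Taubes 1994, proof of Lemma 3): for a solution
`(A, ψ)` of `(SW)` with perturbation `η₀ - (r/4)s`, `r = |c|²`,
`∫_N (|∇_Aψ|² + (κ/4)|ψ|² + |ψ|⁴/4 - (r/4)(|ψ₁|² - |ψ₀|²) + Re⟨½iρ⁺(η₀)ψ, ψ⟩)(s ∧ s) = 0`
(the pointwise identity `re_star_dotProduct_localLaplacian_taubes` integrated, the Laplacian of `|ψ|²`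
dropping out). [cite: Taubes1994, §2 (12)–(13), proof of Lemma 3 (p. 814)] -/
theorem integral_taubes_identity_eq_zero [T2Space N] [CompactSpace N] (hcl : IsClosedForm s)
    (η₀ : (h.canonicalSpincStructure hs hnd).Perturbation) (c : ℂ) {cfg : (h.canonicalSpincStructure hs hnd).Configuration}
    (hsol : SpincStructure.IsSolution (η₀ - h.symplecticPerturbation hs hnd (Complex.normSq c / 4)) cfg) :
    MForm.integral (rayFamily (wedge_self_castDeg_apply_ne_zero s hnd))
      ((fun x ↦ h.gradNormSq hs hnd cfg x
          + (h.canonicalSpincStructure hs hnd).frameScalarCurv ((h.canonicalSpincStructure hs hnd).indexAt x) x / 4 *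
              spinorNormSq (cfg.plusSpinor ((h.canonicalSpincStructure hs hnd).indexAt x) x)
          + spinorNormSq (cfg.plusSpinor ((h.canonicalSpincStructure hs hnd).indexAt x) x) ^ 2 / 4
          - Complex.normSq c / 4 * (Complex.normSq (cfg.plusSpinor ((h.canonicalSpincStructure hs hnd).indexAt x) x 1) -
              Complex.normSq (cfg.plusSpinor ((h.canonicalSpincStructure hs hnd).indexAt x) x 0))
          + (star (cfg.plusSpinor ((h.canonicalSpincStructure hs hnd).indexAt x) x) ⬝ᵥ (((2 : ℂ)⁻¹ * I) •
              (plusAction (twoFormMatrix η₀.form x fun k ↦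
                  (h.canonicalSpincStructure hs hnd).frame ((h.canonicalSpincStructure hs hnd).indexAt x) k x) *ᵥ
                cfg.plusSpinor ((h.canonicalSpincStructure hs hnd).indexAt x) x))).re) •
        (s.wedge s).castDeg two_add_two_eq_four) = 0 := by
  have hint := h.integral_reLaplacian_sub_gradNormSq_eq_zero hs hnd hcl cfg
  have heq : ((fun x ↦ h.reLaplacian hs hnd cfg x - h.gradNormSq hs hnd cfg x) • (s.wedge s).castDeg two_add_two_eq_four) =
      (-1 : ℝ) • ((fun x ↦ h.gradNormSq hs hnd cfg x
          + (h.canonicalSpincStructure hs hnd).frameScalarCurv ((h.canonicalSpincStructure hs hnd).indexAt x) x / 4 *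
              spinorNormSq (cfg.plusSpinor ((h.canonicalSpincStructure hs hnd).indexAt x) x)
          + spinorNormSq (cfg.plusSpinor ((h.canonicalSpincStructure hs hnd).indexAt x) x) ^ 2 / 4
          - Complex.normSq c / 4 * (Complex.normSq (cfg.plusSpinor ((h.canonicalSpincStructure hs hnd).indexAt x) x 1) -
              Complex.normSq (cfg.plusSpinor ((h.canonicalSpincStructure hs hnd).indexAt x) x 0))
          + (star (cfg.plusSpinor ((h.canonicalSpincStructure hs hnd).indexAt x) x) ⬝ᵥ (((2 : ℂ)⁻¹ * I) •
              (plusAction (twoFormMatrix η₀.form x fun k ↦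
                  (h.canonicalSpincStructure hs hnd).frame ((h.canonicalSpincStructure hs hnd).indexAt x) k x) *ᵥ
                cfg.plusSpinor ((h.canonicalSpincStructure hs hnd).indexAt x) x))).re) •
        (s.wedge s).castDeg two_add_two_eq_four) := by
    funext x
    ext w
    have hL : h.reLaplacian hs hnd cfg x = _ :=
      h.re_star_dotProduct_localLaplacian_taubes hs hnd η₀ c hsol ((h.canonicalSpincStructure hs hnd).indexAt x)
        ((h.canonicalSpincStructure hs hnd).mem_baseSet_indexAt x)
    simp [hL]
    ring
  rw [heq, MForm.integral_smul] at hint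
  simpa using hint

end AlmostComplexStructure.IsCompatibleWith

end Literature.Geometry.Symplectic

end
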